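import Literature.Analysis.FluidPDE.TaoHeatFlux
import HarnessLib

/-!
# Tao (2011/2013), proof of Thm. 10.1 (annular form): the heat-flux majorant and the
# pigeonhole choice of the radii

Proved bricks for the assembly of the §10 argument of Tao 2011 (arXiv:1108.1165, proof of
Thm. 10.1 = arXiv Thm. 59, p. 31) in the annular geometry of Remark 10.6, complementing
`TaoHeatFlux.lean` (the bound `Y₃ ≤ (k/2)(a²S(a) + b²S(b)) + k∫_{a<‖x−x₀‖<a+k⁻¹}|ω|²/‖x−x₀‖` for
the annular ramp of slope `k`). Tao controls the heat flux on average over the auxiliary radius: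
"From Fubini's theorem and a change of variables, we see that
`∫_{R−r/4}^R ∫₀ᵀ b_{R'}(t) dt dR' ≲ c^{-0.1}δ² ∫₀ᵀ∫|ω(t,x)|² dx`. From Lemma 8.1, the right-hand side
is `O(δ²E₀/c^{0.1})`. Thus, by the pigeonhole principle, we may select a radius `R'` such that
`∫₀ᵀ b(t) dt ≲ δ²E₀/(c^{0.1}r)`". This file proves exactly this for the two sphere terms of the
annular cutoff, whose radii move with the speed integral (`ρ₁(t) = R₁' + σ(t)/c`,
`ρ₂(t) = R₂' − σ(t)/c`), and bounds the curvature term of the inner ramp: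

* `setIntegral_shell_norm_sq_eq_integral_sphereNormSq` — polar coordinates on a shell about `x₀`
  for `|ζ|²` (`SphereIntegral.setIntegral_shell_eq_integral_sphereIntegral`);
* `continuousOn_sq_mul_sphereNormSq_curl`, `continuousOn_setIntegral_shell_curl_sq` — continuity in
  time of a moving sphere term `ρ(t)²S_t(ρ(t))` and of a fixed shell enstrophy, for a jointly smooth
  field on the closed slab (continuity of parametric integrals over the compact sphere / radius
  interval, after clamping the time variable);
* `exists_radius_intervalIntegral_sphereTerm_le` (and `…_sub_le` for a receding radius) — **the
  pigeonhole**: if `∫₀ᵀ∫|Du|²_F ≤ E` then for a shift `s(t)` continuous on `[0,T]` and `α < β` some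
  `R ∈ [α, β]` has `∫₀ᵀ (R + s(t))² S_t(R + s(t)) dt ≤ ‖curl‖²E/(β − α) + ε` (Fubini on the rectangle,
  the substitution `ρ = R + s(t)`, polar coordinates, `|ω|² ≤ ‖curl‖²|Du|²_F`, and the real-variable
  pigeonhole `exists_le_of_intervalIntegral_le`);
* `mul_setIntegral_layer_inv_norm_le`, `intervalIntegral_setIntegral_shell_curl_sq_le` — the
  curvature term is at most `(k/R₁')∫_{R₁'<‖x−x₀‖<R₂'}|ω|²`, whose time integral is `≤ ‖curl‖²E k/R₁'`.

## Mathlib / tree search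

Tree: `sphereIntegral`, `setIntegral_shell_eq_integral_sphereIntegral`, `continuous_sphereIntegral`
(`SphereIntegral.lean`), `sphereNormSq`, `heatFlux_le` (`TaoHeatFlux.lean`), `continuousOn_curl_slab`
(`TaoLocalisedEnstrophy.lean`), `norm_curl_sq_le_frobeniusNormSq` (`VorticityCalculus.lean`); no
pigeonhole-over-radius statement (`lean search 'pigeonhole|exists_radius'` in FluidPDE: none; an
earlier file `TaoPigeonhole.lean`, p14071, bounced on a missing dependency olean and is not in the
tree). Mathlib: `continuous_parametric_integral_of_continuous`, `integral_integral_swap`,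
`Measure.prod_restrict`, `intervalIntegral.integral_comp_add_right`,
`setIntegral_ge_of_const_le_real`, `integral_eq_lintegral_of_nonneg_ae`.

## References

* T. Tao, *Localisation and compactness properties of the Navier–Stokes global regularity
  problem*, Anal. PDE 6 (2013) 25–107 = arXiv:1108.1165 (`Tao2011`), §10, proof of Thm. 10.1
  (arXiv p. 31: the term `Y₃`, the quantity `b(t)` and the choice of `R'`), Remark 10.6
  (arXiv Rem. 64, p. 33).
-/

noncomputable section

open MeasureTheory Set Function Filter intervalIntegral
open scoped ENNReal NNReal Topology

namespace Literature.Analysis.FluidPDE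


section Shell

variable {T : ℝ} {w : ℝ → EuclideanSpace ℝ (Fin 3) → EuclideanSpace ℝ (Fin 3)}

/-- **Polar coordinates for the shell enstrophy.** For a `C¹` field `ζ` and `0 ≤ a ≤ b`,
`∫_{a<‖x−x₀‖<b} |ζ|² = ∫_{(a,b)} ρ² S(ρ) dρ` with `S(ρ) = ∫_{S²}|ζ(x₀+ρα)|²dσ(α)`
(`sphereNormSq`). [folklore] -/
theorem setIntegral_shell_norm_sq_eq_integral_sphereNormSq
    {ζ : EuclideanSpace ℝ (Fin 3) → EuclideanSpace ℝ (Fin 3)} (hζ : Continuous ζ)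
    (x₀ : EuclideanSpace ℝ (Fin 3)) {a b : ℝ} (ha : 0 ≤ a) :
    ∫ x in {x : EuclideanSpace ℝ (Fin 3) | a < ‖x - x₀‖ ∧ ‖x - x₀‖ < b}, ‖ζ x‖ ^ 2 =
      ∫ ρ in Ioo a b, ρ ^ 2 * sphereNormSq ζ x₀ ρ := by
  rw [setIntegral_comp_sub_centre (fun x => ‖ζ x‖ ^ 2) (fun y => a < ‖y‖ ∧ ‖y‖ < b) x₀]
  have hf : Continuous fun y : EuclideanSpace ℝ (Fin 3) => ‖ζ (x₀ + y)‖ ^ 2 :=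
    (hζ.comp (continuous_const.add continuous_id)).norm.pow 2
  have hK : IsCompact (Metric.closedBall (0 : EuclideanSpace ℝ (Fin 3)) b) := isCompact_closedBall _ _
  have hsub : {y : EuclideanSpace ℝ (Fin 3) | a < ‖y‖ ∧ ‖y‖ < b} ⊆ Metric.closedBall 0 b := fun y hy => by
    simpa using hy.2.le
  have hint : IntegrableOn (fun y : EuclideanSpace ℝ (Fin 3) => ‖ζ (x₀ + y)‖ ^ 2)
      {y | a < ‖y‖ ∧ ‖y‖ < b} volume :=
    (hf.continuousOn.integrableOn_compact hK).mono_set hsub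
  rw [setIntegral_shell_eq_integral_sphereIntegral volume hint ha, finrank_euclideanSpace_fin]
  simp only [show (3 : ℕ) - 1 = 2 by norm_num, smul_eq_mul, sphereNormSq_def]

/-- The shell enstrophy of a slice is dominated by the global dissipation density:
`∫_{shell} |curl v|² ≤ ‖curlCLM‖² ∫ |Dv|²_F` (as extended reals; the shell integrand is
integrable because the shell is bounded and `curl v` is continuous). [folklore] -/
theorem ofReal_setIntegral_curl_sq_le {v : EuclideanSpace ℝ (Fin 3) → EuclideanSpace ℝ (Fin 3)}
    (hv : ContDiff ℝ 1 v) {S : Set (EuclideanSpace ℝ (Fin 3))} (hSb : Bornology.IsBounded S) :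
    ENNReal.ofReal (∫ x in S, ‖FluidPDE.curl v x‖ ^ 2) ≤
      ENNReal.ofReal (‖FluidPDE.curlCLM‖ ^ 2) *
        ∫⁻ x, ENNReal.ofReal (FluidPDE.frobeniusNormSq (fderiv ℝ v x)) := by
  have hc : Continuous fun x => ‖FluidPDE.curl v x‖ ^ 2 := (FluidPDE.continuous_curl hv).norm.pow 2
  obtain ⟨R, hR⟩ := hSb.subset_closedBall 0
  have hint : IntegrableOn (fun x => ‖FluidPDE.curl v x‖ ^ 2) S volume :=
    (hc.continuousOn.integrableOn_compact (isCompact_closedBall _ _)).mono_set hR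
  rw [ofReal_integral_eq_lintegral_ofReal hint (ae_of_all _ fun x => sq_nonneg _),
    ← lintegral_const_mul' _ _ ENNReal.ofReal_ne_top]
  calc ∫⁻ x in S, ENNReal.ofReal (‖FluidPDE.curl v x‖ ^ 2)
      ≤ ∫⁻ x, ENNReal.ofReal (‖FluidPDE.curl v x‖ ^ 2) := setLIntegral_le_lintegral _ _
    _ ≤ ∫⁻ x, ENNReal.ofReal (‖FluidPDE.curlCLM‖ ^ 2) *
          ENNReal.ofReal (FluidPDE.frobeniusNormSq (fderiv ℝ v x)) := by
        refine lintegral_mono fun x => ?_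
        rw [← ENNReal.ofReal_mul (sq_nonneg _)]
        exact ENNReal.ofReal_le_ofReal (FluidPDE.norm_curl_sq_le_frobeniusNormSq v x)

/-- Joint continuity in (clamped time, radius) of the sphere functional
`(τ, r) ↦ S_τ(r) = ∫_{S²} |curl w(τ)(x₀ + rα)|² dσ(α)` for a jointly smooth field on the closed
slab (the time variable is clamped to `[0, T]` by `projIcc`). [folklore] -/
theorem continuous_sphereNormSq_curl_projIcc (hT : 0 < T)
    (hw : FluidPDE.IsSmoothSpaceTimeOn (Icc 0 T) w) (x₀ : EuclideanSpace ℝ (Fin 3)) :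
    Continuous (fun q : ℝ × ℝ =>
      sphereNormSq (FluidPDE.curl (w (Set.projIcc 0 T hT.le q.1 : ℝ))) x₀ q.2) := by
  have hcurl := continuousOn_curl_slab hT hw
  have hF : Continuous (uncurry fun (q : ℝ × ℝ) (α : Metric.sphere (0 : EuclideanSpace ℝ (Fin 3)) 1) =>
      ‖FluidPDE.curl (w (Set.projIcc 0 T hT.le q.1 : ℝ)) (x₀ + q.2 • (α : EuclideanSpace ℝ (Fin 3)))‖ ^ 2) := by
    have h1 : Continuous (fun z : (ℝ × ℝ) × Metric.sphere (0 : EuclideanSpace ℝ (Fin 3)) 1 =>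
        ((Set.projIcc 0 T hT.le z.1.1 : ℝ), x₀ + z.1.2 • (z.2 : EuclideanSpace ℝ (Fin 3)))) := by
      refine Continuous.prodMk ?_ ?_
      · exact continuous_subtype_val.comp (continuous_projIcc.comp (continuous_fst.comp continuous_fst))
      · exact continuous_const.add ((continuous_snd.comp continuous_fst).smul
          (continuous_subtype_val.comp continuous_snd))
    have h2 : ∀ z : (ℝ × ℝ) × Metric.sphere (0 : EuclideanSpace ℝ (Fin 3)) 1,
        ((Set.projIcc 0 T hT.le z.1.1 : ℝ), x₀ + z.1.2 • (z.2 : EuclideanSpace ℝ (Fin 3))) ∈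
          Icc 0 T ×ˢ (univ : Set (EuclideanSpace ℝ (Fin 3))) := fun z =>
      mk_mem_prod (Set.projIcc 0 T hT.le z.1.1).2 (mem_univ _)
    exact ((hcurl.comp_continuous h1 h2).norm.pow 2)
  have h := continuous_parametric_integral_of_continuous
    (μ := (volume : Measure (EuclideanSpace ℝ (Fin 3))).toSphere) hF isCompact_univ
  simp only [Measure.restrict_univ] at h
  simpa [sphereNormSq_def, sphereIntegral_def] using h

/-- Joint continuity on `[0, T] × ℝ` of `(τ, r) ↦ S_τ(r)` (unclamped). [folklore] -/
theorem continuousOn_sphereNormSq_curl (hT : 0 < T)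
    (hw : FluidPDE.IsSmoothSpaceTimeOn (Icc 0 T) w) (x₀ : EuclideanSpace ℝ (Fin 3)) :
    ContinuousOn (fun q : ℝ × ℝ => sphereNormSq (FluidPDE.curl (w q.1)) x₀ q.2)
      (Icc 0 T ×ˢ univ) := by
  refine (continuous_sphereNormSq_curl_projIcc hT hw x₀).continuousOn.congr ?_
  intro q hq
  rw [Set.mem_prod] at hq
  have hq1 : (Set.projIcc 0 T hT.le q.1 : ℝ) = q.1 :=
    congrArg Subtype.val (Set.projIcc_of_mem hT.le hq.1)
  dsimp only
  rw [hq1]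

/-- Continuity in time of a moving sphere term `τ ↦ ρ(τ)² S_τ(ρ(τ))` along a radius function
`ρ` continuous on `[0, T]` (the two sphere terms of Tao's `b(t)`). [cite: Tao2011, §10, proof of Thm. 10.1 (the quantity b(t))] -/
theorem continuousOn_sq_mul_sphereNormSq_curl (hT : 0 < T)
    (hw : FluidPDE.IsSmoothSpaceTimeOn (Icc 0 T) w) (x₀ : EuclideanSpace ℝ (Fin 3)) {ρ : ℝ → ℝ}
    (hρ : ContinuousOn ρ (Icc 0 T)) :
    ContinuousOn (fun τ => ρ τ ^ 2 * sphereNormSq (FluidPDE.curl (w τ)) x₀ (ρ τ)) (Icc 0 T) := by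
  have h1 : ContinuousOn (fun τ : ℝ => (τ, ρ τ)) (Icc 0 T) := continuousOn_id.prodMk hρ
  have h2 : MapsTo (fun τ : ℝ => (τ, ρ τ)) (Icc 0 T) (Icc 0 T ×ˢ univ) := fun τ hτ =>
    mk_mem_prod hτ (mem_univ _)
  have h3 : ContinuousOn ((fun q : ℝ × ℝ => sphereNormSq (FluidPDE.curl (w q.1)) x₀ q.2) ∘
      (fun τ : ℝ => (τ, ρ τ))) (Icc 0 T) := (continuousOn_sphereNormSq_curl hT hw x₀).comp h1 h2
  rw [Function.comp_def] at h3
  exact (hρ.pow 2).mul h3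

/-- **Continuity in time of the shell enstrophy** `τ ↦ ∫_{a<‖x−x₀‖<b} |curl w(τ)|²` on `[0, T]`
for a fixed shell with `0 ≤ a` (polar coordinates and continuity of the parametric integral
`∫_{[a,b]} ρ² S_τ(ρ) dρ`). [folklore] -/
theorem continuousOn_setIntegral_shell_curl_sq (hT : 0 < T)
    (hw : FluidPDE.IsSmoothSpaceTimeOn (Icc 0 T) w) (x₀ : EuclideanSpace ℝ (Fin 3)) {a b : ℝ}
    (ha : 0 ≤ a) :
    ContinuousOn (fun τ => ∫ x in {x : EuclideanSpace ℝ (Fin 3) | a < ‖x - x₀‖ ∧ ‖x - x₀‖ < b},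
      ‖FluidPDE.curl (w τ) x‖ ^ 2) (Icc 0 T) := by
  -- rewrite through polar coordinates, with the clamped (globally continuous) sphere functional
  have hpol : ∀ τ ∈ Icc 0 T,
      (∫ x in {x : EuclideanSpace ℝ (Fin 3) | a < ‖x - x₀‖ ∧ ‖x - x₀‖ < b}, ‖FluidPDE.curl (w τ) x‖ ^ 2) =
        ∫ ρ in Icc a b, ρ ^ 2 *
          sphereNormSq (FluidPDE.curl (w (Set.projIcc 0 T hT.le τ : ℝ))) x₀ ρ := by
    intro τ hτ
    have hc : Continuous (FluidPDE.curl (w τ)) :=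
      FluidPDE.continuous_curl ((hw.contDiff_slice hτ).of_le (by norm_cast))
    rw [setIntegral_shell_norm_sq_eq_integral_sphereNormSq hc x₀ ha, integral_Icc_eq_integral_Ioo,
      Set.projIcc_of_mem hT.le hτ]
  refine ContinuousOn.congr ?_ hpol
  have hG : Continuous (uncurry fun (τ ρ : ℝ) => ρ ^ 2 *
      sphereNormSq (FluidPDE.curl (w (Set.projIcc 0 T hT.le τ : ℝ))) x₀ ρ) :=
    (continuous_snd.pow 2).mul (continuous_sphereNormSq_curl_projIcc hT hw x₀)
  exact (continuous_parametric_integral_of_continuous (μ := (volume : Measure ℝ)) hG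
    isCompact_Icc).continuousOn

end Shell



/-! ## Real-variable lemmas for the pigeonhole -/

/-- Fubini on a rectangle for a jointly continuous integrand, interval-integral form. [folklore] -/
theorem intervalIntegral_swap_of_continuousOn {f : ℝ → ℝ → ℝ} {a b c d : ℝ} (hab : a ≤ b)
    (hcd : c ≤ d) (hf : ContinuousOn (uncurry f) (Icc a b ×ˢ Icc c d)) :
    ∫ x in a..b, ∫ y in c..d, f x y = ∫ y in c..d, ∫ x in a..b, f x y := by
  have h1 : (fun x => ∫ y in c..d, f x y) = fun x => ∫ y in Ioc c d, f x y := by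
    funext x; rw [intervalIntegral.integral_of_le hcd]
  have h2 : (fun y => ∫ x in a..b, f x y) = fun y => ∫ x in Ioc a b, f x y := by
    funext y; rw [intervalIntegral.integral_of_le hab]
  rw [intervalIntegral.integral_of_le hab, intervalIntegral.integral_of_le hcd, h1, h2]
  refine MeasureTheory.integral_integral_swap ?_
  rw [Measure.prod_restrict, ← Measure.volume_eq_prod]
  exact (hf.integrableOn_compact (isCompact_Icc.prod isCompact_Icc)).mono_set
    (prod_mono Ioc_subset_Icc_self Ioc_subset_Icc_self)

/-- Joint continuity on `[a, b] × [c, d]` makes the partial integral `y ↦ ∫ₐᵇ f(x, y) dx`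
continuous on `[c, d]` (clamp both variables and use continuity of parametric integrals over the
compact `[a, b]`). [folklore] -/
theorem continuousOn_intervalIntegral_of_continuousOn {f : ℝ → ℝ → ℝ} {a b c d : ℝ} (hab : a ≤ b)
    (hcd : c ≤ d) (hf : ContinuousOn (uncurry f) (Icc a b ×ˢ Icc c d)) :
    ContinuousOn (fun y => ∫ x in a..b, f x y) (Icc c d) := by
  set F : ℝ → ℝ → ℝ := fun y x => f (Set.projIcc a b hab x : ℝ) (Set.projIcc c d hcd y : ℝ) with hFdef
  have hF : Continuous (uncurry F) := by
    have h1 : Continuous fun q : ℝ × ℝ =>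
        ((Set.projIcc a b hab q.2 : ℝ), (Set.projIcc c d hcd q.1 : ℝ)) :=
      (continuous_subtype_val.comp (continuous_projIcc.comp continuous_snd)).prodMk
        (continuous_subtype_val.comp (continuous_projIcc.comp continuous_fst))
    exact hf.comp_continuous h1 fun q =>
      mk_mem_prod (Set.projIcc a b hab q.2).2 (Set.projIcc c d hcd q.1).2
  have hcont : Continuous fun y => ∫ x in Icc a b, F y x :=
    continuous_parametric_integral_of_continuous (μ := (volume : Measure ℝ)) hF isCompact_Icc
  refine hcont.continuousOn.congr fun y hy => ?_
  dsimp only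
  rw [intervalIntegral.integral_of_le hab, ← integral_Icc_eq_integral_Ioc]
  refine setIntegral_congr_fun measurableSet_Icc fun x hx => ?_
  simp only [hFdef, Set.projIcc_of_mem hab hx, Set.projIcc_of_mem hcd hy]

/-- **Pigeonhole on an interval.** If `φ` is continuous on `[α, β]` (`α < β`) with
`∫_α^β φ ≤ V`, then for every `ε > 0` some `R ∈ [α, β]` has `φ(R) ≤ V/(β − α) + ε` (Tao: "by the
pigeonhole principle, we may select a radius `R'` such that …"). [folklore] -/
theorem exists_le_of_intervalIntegral_le {φ : ℝ → ℝ} {α β V ε : ℝ} (hαβ : α < β)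
    (hφ : ContinuousOn φ (Icc α β)) (hV : ∫ R in α..β, φ R ≤ V) (hε : 0 < ε) :
    ∃ R ∈ Icc α β, φ R ≤ V / (β - α) + ε := by
  by_contra hcon
  push Not at hcon
  have hL : 0 < β - α := sub_pos.2 hαβ
  have hint : IntegrableOn φ (Icc α β) volume := hφ.integrableOn_compact isCompact_Icc
  have hge : (V / (β - α) + ε) * (volume (Icc α β)).toReal ≤ ∫ R in Icc α β, φ R :=
    setIntegral_ge_of_const_le_real measurableSet_Icc (by simp)
      (fun R hR => (hcon R hR).le) hint
  rw [Real.volume_Icc, ENNReal.toReal_ofReal hL.le, integral_Icc_eq_integral_Ioc,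
    ← intervalIntegral.integral_of_le hαβ.le] at hge
  have : (V / (β - α) + ε) * (β - α) = V + ε * (β - α) := by field_simp
  nlinarith [mul_pos hε hL]

/-- From an extended-real bound on a nonnegative integrand to a bound on its interval integral:
if `ofReal (g τ) ≤ C · G τ` on `(0, T)` and `∫⁻_{(0,T)} G ≤ ofReal E`, then
`∫₀ᵀ g ≤ C.toReal · E`. [folklore] -/
theorem intervalIntegral_le_of_ofReal_le {g : ℝ → ℝ} {G : ℝ → ℝ≥0∞} {T E : ℝ} {C : ℝ≥0∞}
    (hT : 0 < T) (hE : 0 ≤ E) (hC : C ≠ ⊤) (hgi : IntervalIntegrable g volume 0 T)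
    (hg0 : ∀ τ ∈ Ioo 0 T, 0 ≤ g τ) (hle : ∀ τ ∈ Ioo 0 T, ENNReal.ofReal (g τ) ≤ C * G τ)
    (hG : ∫⁻ τ in Ioo 0 T, G τ ≤ ENNReal.ofReal E) :
    ∫ τ in (0)..T, g τ ≤ C.toReal * E := by
  rw [intervalIntegral.integral_of_le hT.le, integral_Ioc_eq_integral_Ioo]
  have hgi' : IntegrableOn g (Ioo 0 T) volume := by
    have := (intervalIntegrable_iff_integrableOn_Ioc_of_le hT.le).1 hgi
    exact this.mono_set Ioo_subset_Ioc_self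
  have hnn : 0 ≤ᵐ[volume.restrict (Ioo 0 T)] g :=
    (ae_restrict_iff' measurableSet_Ioo).2 (Eventually.of_forall hg0)
  rw [integral_eq_lintegral_of_nonneg_ae hnn hgi'.aestronglyMeasurable]
  have h1 : ∫⁻ τ in Ioo 0 T, ENNReal.ofReal (g τ) ≤ C * ENNReal.ofReal E :=
    calc ∫⁻ τ in Ioo 0 T, ENNReal.ofReal (g τ) ≤ ∫⁻ τ in Ioo 0 T, C * G τ :=
          setLIntegral_mono' measurableSet_Ioo fun τ hτ => hle τ hτ
      _ = C * ∫⁻ τ in Ioo 0 T, G τ := lintegral_const_mul' _ _ hC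
      _ ≤ C * ENNReal.ofReal E := by gcongr
  have h2 : (C * ENNReal.ofReal E).toReal = C.toReal * E := by
    rw [ENNReal.toReal_mul, ENNReal.toReal_ofReal hE]
  rw [← h2]
  exact ENNReal.toReal_mono (ENNReal.mul_ne_top hC ENNReal.ofReal_ne_top) h1


section Pigeonhole

variable {T : ℝ} {w : ℝ → EuclideanSpace ℝ (Fin 3) → EuclideanSpace ℝ (Fin 3)}

/-- Shells about `x₀` are bounded. [folklore] -/
theorem isBounded_shell (x₀ : EuclideanSpace ℝ (Fin 3)) (a b : ℝ) :
    Bornology.IsBounded {x : EuclideanSpace ℝ (Fin 3) | a < ‖x - x₀‖ ∧ ‖x - x₀‖ < b} :=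
  (Metric.isBounded_closedBall (x := x₀) (r := b)).subset fun x hx => by
    simpa [Metric.mem_closedBall, dist_eq_norm] using hx.2.le

/-- Shells about `x₀` are measurable. [folklore] -/
theorem measurableSet_shell_centre (x₀ : EuclideanSpace ℝ (Fin 3)) (a b : ℝ) :
    MeasurableSet {x : EuclideanSpace ℝ (Fin 3) | a < ‖x - x₀‖ ∧ ‖x - x₀‖ < b} := by
  have hn : Continuous fun x : EuclideanSpace ℝ (Fin 3) => ‖x - x₀‖ := by fun_prop
  exact (isOpen_lt continuous_const hn).measurableSet.inter (isOpen_lt hn continuous_const).measurableSet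

/-- **Averaging a moving sphere term over the radius parameter** (the change of variables in
Tao's pigeonhole argument, p. 31: "From Fubini's theorem and a change of variables"): for a
continuous `ζ`, a shift `s` with `0 ≤ α + s` and `α ≤ β`,
`∫_α^β (R + s)² S(R + s) dR = ∫_{α+s<‖x−x₀‖<β+s} |ζ|²`. [cite: Tao2011, §10, proof of Thm. 10.1 (choice of R')] -/
theorem intervalIntegral_sq_mul_sphereNormSq_comp_add
    {ζ : EuclideanSpace ℝ (Fin 3) → EuclideanSpace ℝ (Fin 3)} (hζ : Continuous ζ)
    (x₀ : EuclideanSpace ℝ (Fin 3)) {α β s : ℝ} (hαβ : α ≤ β) (hpos : 0 ≤ α + s) :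
    ∫ R in α..β, (R + s) ^ 2 * sphereNormSq ζ x₀ (R + s) =
      ∫ x in {x : EuclideanSpace ℝ (Fin 3) | α + s < ‖x - x₀‖ ∧ ‖x - x₀‖ < β + s}, ‖ζ x‖ ^ 2 := by
  rw [intervalIntegral.integral_comp_add_right (fun ρ => ρ ^ 2 * sphereNormSq ζ x₀ ρ) s,
    intervalIntegral.integral_of_le (by linarith), integral_Ioc_eq_integral_Ioo,
    setIntegral_shell_norm_sq_eq_integral_sphereNormSq hζ x₀ hpos]

/-- **Pigeonhole choice of a radius** (Tao 2011, proof of Thm. 10.1, p. 31: "∫∫ b_{R'}(t) dt dR'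
≲ c^{-0.1}δ² ∫₀ᵀ∫|ω|² … Thus, by the pigeonhole principle, we may select a radius `R'` such that
…"), for one moving sphere term: if `∫₀ᵀ∫|Dw|²_F ≤ E` then for every shift `s(τ)` continuous on
`[0, T]` with `α + s ≥ 0`, every `α < β` and `ε > 0` there is `R ∈ [α, β]` with
`∫₀ᵀ (R + s(τ))² S_τ(R + s(τ)) dτ ≤ ‖curl‖² E/(β − α) + ε`. [cite: Tao2011, §10, proof of Thm. 10.1 (choice of R')] -/
theorem exists_radius_intervalIntegral_sphereTerm_le (hT : 0 < T)
    (hw : FluidPDE.IsSmoothSpaceTimeOn (Icc 0 T) w) {E : ℝ} (hE : 0 ≤ E)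
    (hD : ∫⁻ τ in Ioo 0 T, ∫⁻ x, ENNReal.ofReal (FluidPDE.frobeniusNormSq (fderiv ℝ (w τ) x)) ≤
      ENNReal.ofReal E)
    (x₀ : EuclideanSpace ℝ (Fin 3)) {s : ℝ → ℝ} (hs : ContinuousOn s (Icc 0 T)) {α β : ℝ}
    (hαβ : α < β) (hpos : ∀ τ ∈ Icc 0 T, 0 ≤ α + s τ) {ε : ℝ} (hε : 0 < ε) :
    ∃ R ∈ Icc α β, ∫ τ in (0)..T, (R + s τ) ^ 2 * sphereNormSq (FluidPDE.curl (w τ)) x₀ (R + s τ) ≤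
      ‖FluidPDE.curlCLM‖ ^ 2 * E / (β - α) + ε := by
  -- the integrand `f R τ` is jointly continuous on `[α, β] × [0, T]`
  set f : ℝ → ℝ → ℝ := fun R τ => (R + s τ) ^ 2 * sphereNormSq (FluidPDE.curl (w τ)) x₀ (R + s τ)
    with hfdef
  have hφ : ContinuousOn (fun q : ℝ × ℝ => (q.2, q.1 + s q.2)) (Icc α β ×ˢ Icc 0 T) :=
    continuousOn_snd.prodMk (continuousOn_fst.add (hs.comp continuousOn_snd fun q hq => hq.2))
  have hmaps : MapsTo (fun q : ℝ × ℝ => (q.2, q.1 + s q.2)) (Icc α β ×ˢ Icc 0 T)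
      (Icc 0 T ×ˢ univ) := fun q hq => mk_mem_prod hq.2 (mem_univ _)
  have hS : ContinuousOn ((fun q : ℝ × ℝ => sphereNormSq (FluidPDE.curl (w q.1)) x₀ q.2) ∘
      (fun q : ℝ × ℝ => (q.2, q.1 + s q.2))) (Icc α β ×ˢ Icc 0 T) :=
    (continuousOn_sphereNormSq_curl hT hw x₀).comp hφ hmaps
  rw [Function.comp_def] at hS
  have hadd : ContinuousOn (fun q : ℝ × ℝ => q.1 + s q.2) (Icc α β ×ˢ Icc 0 T) :=
    continuousOn_fst.add (hs.comp continuousOn_snd fun q hq => hq.2)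
  have hf : ContinuousOn (uncurry f) (Icc α β ×ˢ Icc 0 T) := (hadd.pow 2).mul hS
  have hf' : ContinuousOn (uncurry fun τ R => f R τ) (Icc 0 T ×ˢ Icc α β) := by
    refine (hf.comp continuous_swap.continuousOn ?_).congr fun _ _ => rfl
    rintro ⟨τ, R⟩ ⟨hτ, hR⟩
    exact mk_mem_prod hR hτ
  -- `Φ(R) = ∫₀ᵀ f(R, τ) dτ` is continuous on `[α, β]`
  have hΦ : ContinuousOn (fun R => ∫ τ in (0)..T, f R τ) (Icc α β) :=
    continuousOn_intervalIntegral_of_continuousOn hT.le hαβ.le hf'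
  -- the inner integral in `R`, a shell enstrophy, and its bound
  have hinner : ∀ τ ∈ Icc 0 T, ∫ R in α..β, f R τ =
      ∫ x in {x : EuclideanSpace ℝ (Fin 3) | α + s τ < ‖x - x₀‖ ∧ ‖x - x₀‖ < β + s τ},
        ‖FluidPDE.curl (w τ) x‖ ^ 2 := by
    intro τ hτ
    have hc : Continuous (FluidPDE.curl (w τ)) :=
      FluidPDE.continuous_curl ((hw.contDiff_slice hτ).of_le (by norm_cast))
    exact intervalIntegral_sq_mul_sphereNormSq_comp_add hc x₀ hαβ.le (hpos τ hτ)
  have hg : ContinuousOn (fun τ => ∫ R in α..β, f R τ) (Icc 0 T) :=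
    continuousOn_intervalIntegral_of_continuousOn hαβ.le hT.le hf
  have hV : ∫ R in α..β, ∫ τ in (0)..T, f R τ ≤ ‖FluidPDE.curlCLM‖ ^ 2 * E := by
    rw [intervalIntegral_swap_of_continuousOn hαβ.le hT.le hf]
    have h := intervalIntegral_le_of_ofReal_le (g := fun τ => ∫ R in α..β, f R τ)
      (G := fun τ => ∫⁻ x, ENNReal.ofReal (FluidPDE.frobeniusNormSq (fderiv ℝ (w τ) x)))
      (C := ENNReal.ofReal (‖FluidPDE.curlCLM‖ ^ 2)) hT hE ENNReal.ofReal_ne_top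
      (hg.intervalIntegrable_of_Icc hT.le) ?_ ?_ hD
    · rwa [ENNReal.toReal_ofReal (sq_nonneg _)] at h
    · intro τ hτ
      rw [hinner τ (Ioo_subset_Icc_self hτ)]
      exact setIntegral_nonneg (measurableSet_shell_centre x₀ _ _) fun x _ => sq_nonneg _
    · intro τ hτ
      have hτ' := Ioo_subset_Icc_self hτ
      rw [hinner τ hτ']
      exact ofReal_setIntegral_curl_sq_le ((hw.contDiff_slice hτ').of_le (by norm_cast))
        (isBounded_shell x₀ _ _)
  exact exists_le_of_intervalIntegral_le hαβ hΦ hV hε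

end Pigeonhole

section PigeonholeCorollaries

variable {T : ℝ} {w : ℝ → EuclideanSpace ℝ (Fin 3) → EuclideanSpace ℝ (Fin 3)}

/-- The pigeonhole choice for a **receding** sphere `ρ(τ) = R − s(τ)` (the outer radius
`R₂'(t) = R₂' − c⁻¹∫₀ᵗ‖u‖_{L^∞}` of the annular cutoff): for `s` continuous with `α − s ≥ 0` there is
`R ∈ [α, β]` with `∫₀ᵀ (R − s(τ))² S_τ(R − s(τ)) dτ ≤ ‖curl‖² E/(β − α) + ε`. [cite: Tao2011, §10, proof of Thm. 10.1 (choice of R') + Remark 10.6] -/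
theorem exists_radius_intervalIntegral_sphereTerm_sub_le (hT : 0 < T)
    (hw : FluidPDE.IsSmoothSpaceTimeOn (Icc 0 T) w) {E : ℝ} (hE : 0 ≤ E)
    (hD : ∫⁻ τ in Ioo 0 T, ∫⁻ x, ENNReal.ofReal (FluidPDE.frobeniusNormSq (fderiv ℝ (w τ) x)) ≤
      ENNReal.ofReal E)
    (x₀ : EuclideanSpace ℝ (Fin 3)) {s : ℝ → ℝ} (hs : ContinuousOn s (Icc 0 T)) {α β : ℝ}
    (hαβ : α < β) (hpos : ∀ τ ∈ Icc 0 T, 0 ≤ α - s τ) {ε : ℝ} (hε : 0 < ε) :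
    ∃ R ∈ Icc α β, ∫ τ in (0)..T, (R - s τ) ^ 2 * sphereNormSq (FluidPDE.curl (w τ)) x₀ (R - s τ) ≤
      ‖FluidPDE.curlCLM‖ ^ 2 * E / (β - α) + ε := by
  obtain ⟨R, hR, h⟩ := exists_radius_intervalIntegral_sphereTerm_le hT hw hE hD x₀ (s := fun τ => -s τ)
    hs.neg hαβ (fun τ hτ => by simpa [sub_eq_add_neg] using hpos τ hτ) hε
  refine ⟨R, hR, ?_⟩
  simpa [sub_eq_add_neg] using h

/-- **The curvature term of the heat flux is dominated by the shell enstrophy**: for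
`0 < R₁' ≤ a` and `a + ℓ ≤ R₂'`,
`k ∫_{a<‖x−x₀‖<a+ℓ} |ζ|²/‖x−x₀‖ ≤ (k/R₁') ∫_{R₁'<‖x−x₀‖<R₂'} |ζ|²` (on the inner layer
`‖x − x₀‖ > a ≥ R₁'`, and the layer lies in the source shell). [cite: Tao2011, §10, proof of Thm. 10.1 (Y₃ ≲ b(t)) + Remark 10.6] -/
theorem mul_setIntegral_layer_inv_norm_le {ζ : EuclideanSpace ℝ (Fin 3) → EuclideanSpace ℝ (Fin 3)}
    (hζ : Continuous ζ) (x₀ : EuclideanSpace ℝ (Fin 3)) {k R₁' R₂' a ℓ : ℝ} (hk : 0 ≤ k)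
    (hR₁ : 0 < R₁') (ha : R₁' ≤ a) (hb : a + ℓ ≤ R₂') :
    k * ∫ x in {x : EuclideanSpace ℝ (Fin 3) | a < ‖x - x₀‖ ∧ ‖x - x₀‖ < a + ℓ}, ‖x - x₀‖⁻¹ * ‖ζ x‖ ^ 2 ≤
      k / R₁' * ∫ x in {x : EuclideanSpace ℝ (Fin 3) | R₁' < ‖x - x₀‖ ∧ ‖x - x₀‖ < R₂'}, ‖ζ x‖ ^ 2 := by
  have hc2 : Continuous fun x => ‖ζ x‖ ^ 2 := hζ.norm.pow 2
  have hL := measurableSet_shell_centre x₀ a (a + ℓ)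
  have hSm := measurableSet_shell_centre x₀ R₁' R₂'
  have hsub : {x : EuclideanSpace ℝ (Fin 3) | a < ‖x - x₀‖ ∧ ‖x - x₀‖ < a + ℓ} ⊆
      {x | R₁' < ‖x - x₀‖ ∧ ‖x - x₀‖ < R₂'} := fun x hx =>
    ⟨lt_of_le_of_lt ha hx.1, lt_of_lt_of_le hx.2 hb⟩
  have hintS : IntegrableOn (fun x => ‖ζ x‖ ^ 2) {x | R₁' < ‖x - x₀‖ ∧ ‖x - x₀‖ < R₂'} volume := by
    obtain ⟨R, hR⟩ := (isBounded_shell x₀ R₁' R₂').subset_closedBall 0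
    exact (hc2.continuousOn.integrableOn_compact (isCompact_closedBall _ _)).mono_set hR
  have hintL : IntegrableOn (fun x => ‖ζ x‖ ^ 2) {x | a < ‖x - x₀‖ ∧ ‖x - x₀‖ < a + ℓ} volume :=
    hintS.mono_set hsub
  -- pointwise on the layer: `‖x − x₀‖⁻¹ |ζ|² ≤ R₁'⁻¹ |ζ|²`
  have hpt : ∀ x ∈ {x : EuclideanSpace ℝ (Fin 3) | a < ‖x - x₀‖ ∧ ‖x - x₀‖ < a + ℓ},
      ‖x - x₀‖⁻¹ * ‖ζ x‖ ^ 2 ≤ R₁'⁻¹ * ‖ζ x‖ ^ 2 := fun x hx =>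
    mul_le_mul_of_nonneg_right (inv_anti₀ hR₁ (ha.trans hx.1.le)) (sq_nonneg _)
  have hintL' : IntegrableOn (fun x => ‖x - x₀‖⁻¹ * ‖ζ x‖ ^ 2)
      {x | a < ‖x - x₀‖ ∧ ‖x - x₀‖ < a + ℓ} volume := by
    refine Integrable.mono' (hintL.const_mul R₁'⁻¹) ?_ ?_
    · have hn : Continuous fun x : EuclideanSpace ℝ (Fin 3) => ‖x - x₀‖ := by fun_prop
      exact ((hn.measurable.inv).mul hc2.measurable).aestronglyMeasurable
    · refine (ae_restrict_iff' hL).2 (Eventually.of_forall fun x hx => ?_)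
      rw [Real.norm_eq_abs, abs_of_nonneg (mul_nonneg (inv_nonneg.2 (norm_nonneg _)) (sq_nonneg _))]
      exact hpt x hx
  have h1 : ∫ x in {x : EuclideanSpace ℝ (Fin 3) | a < ‖x - x₀‖ ∧ ‖x - x₀‖ < a + ℓ}, ‖x - x₀‖⁻¹ * ‖ζ x‖ ^ 2 ≤
      ∫ x in {x : EuclideanSpace ℝ (Fin 3) | a < ‖x - x₀‖ ∧ ‖x - x₀‖ < a + ℓ}, R₁'⁻¹ * ‖ζ x‖ ^ 2 :=
    setIntegral_mono_on hintL' (hintL.const_mul _) hL hpt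
  have h2 : ∫ x in {x : EuclideanSpace ℝ (Fin 3) | a < ‖x - x₀‖ ∧ ‖x - x₀‖ < a + ℓ}, R₁'⁻¹ * ‖ζ x‖ ^ 2 ≤
      ∫ x in {x : EuclideanSpace ℝ (Fin 3) | R₁' < ‖x - x₀‖ ∧ ‖x - x₀‖ < R₂'}, R₁'⁻¹ * ‖ζ x‖ ^ 2 :=
    setIntegral_mono_set (hintS.const_mul _)
      (Eventually.of_forall fun x => mul_nonneg (inv_nonneg.2 hR₁.le) (sq_nonneg _))
      (Eventually.of_forall hsub)
  rw [MeasureTheory.integral_const_mul, MeasureTheory.integral_const_mul] at h2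
  rw [MeasureTheory.integral_const_mul] at h1
  calc k * ∫ x in {x : EuclideanSpace ℝ (Fin 3) | a < ‖x - x₀‖ ∧ ‖x - x₀‖ < a + ℓ}, ‖x - x₀‖⁻¹ * ‖ζ x‖ ^ 2
      ≤ k * (R₁'⁻¹ * ∫ x in {x | R₁' < ‖x - x₀‖ ∧ ‖x - x₀‖ < R₂'}, ‖ζ x‖ ^ 2) :=
        mul_le_mul_of_nonneg_left (h1.trans h2) hk
    _ = k / R₁' * ∫ x in {x | R₁' < ‖x - x₀‖ ∧ ‖x - x₀‖ < R₂'}, ‖ζ x‖ ^ 2 := by ring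

/-- **Time integral of the shell enstrophy**: if `∫₀ᵀ∫|Dw|²_F ≤ E` then
`∫₀ᵀ ∫_{a<‖x−x₀‖<b} |curl w(τ)|² dx dτ ≤ ‖curl‖² E` (`0 ≤ a`). [cite: Tao2011, §10, proof of Thm. 10.1 ("From Lemma 8.1, the right-hand side is O(δ²E₀/c^{0.1})")] -/
theorem intervalIntegral_setIntegral_shell_curl_sq_le (hT : 0 < T)
    (hw : FluidPDE.IsSmoothSpaceTimeOn (Icc 0 T) w) {E : ℝ} (hE : 0 ≤ E)
    (hD : ∫⁻ τ in Ioo 0 T, ∫⁻ x, ENNReal.ofReal (FluidPDE.frobeniusNormSq (fderiv ℝ (w τ) x)) ≤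
      ENNReal.ofReal E)
    (x₀ : EuclideanSpace ℝ (Fin 3)) {a b : ℝ} (ha : 0 ≤ a) :
    ∫ τ in (0)..T, ∫ x in {x : EuclideanSpace ℝ (Fin 3) | a < ‖x - x₀‖ ∧ ‖x - x₀‖ < b},
        ‖FluidPDE.curl (w τ) x‖ ^ 2 ≤ ‖FluidPDE.curlCLM‖ ^ 2 * E := by
  have hg := continuousOn_setIntegral_shell_curl_sq hT hw x₀ (b := b) ha
  have h := intervalIntegral_le_of_ofReal_le
    (g := fun τ => ∫ x in {x : EuclideanSpace ℝ (Fin 3) | a < ‖x - x₀‖ ∧ ‖x - x₀‖ < b},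
      ‖FluidPDE.curl (w τ) x‖ ^ 2)
    (G := fun τ => ∫⁻ x, ENNReal.ofReal (FluidPDE.frobeniusNormSq (fderiv ℝ (w τ) x)))
    (C := ENNReal.ofReal (‖FluidPDE.curlCLM‖ ^ 2)) hT hE ENNReal.ofReal_ne_top
    (hg.intervalIntegrable_of_Icc hT.le)
    (fun τ _ => setIntegral_nonneg (measurableSet_shell_centre x₀ _ _) fun x _ => sq_nonneg _)
    (fun τ hτ => ofReal_setIntegral_curl_sq_le
      ((hw.contDiff_slice (Ioo_subset_Icc_self hτ)).of_le (by norm_cast)) (isBounded_shell x₀ _ _)) hD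
  rwa [ENNReal.toReal_ofReal (sq_nonneg _)] at h

end PigeonholeCorollaries


end Literature.Analysis.FluidPDE

end
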